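import Summits.BirchSwinnertonDyer.BirchSwinnertonDyer.Theorems.EisensteinPrimesMazurMCOnCellBTwistbackTwistLineCharacters
import Summits.BirchSwinnertonDyer.Rank1Residual.Additive.X3BranchLineCharacterQuadratic
import Summits.BirchSwinnertonDyer.Rank1Residual.Additive.X3BranchLineCharacterPrimeDisc
import Literature.NumberTheory.GaloisRepresentations.ImaginaryQuadraticCyclotomicProofs
import Mathlib.NumberTheory.LegendreSymbol.JacobiSymbol
import HarnessLib

/-!
# Crux 3 `MazurMCOnCellB` (stmt-BirchSwinnertonDyer-19033), line `twistback` v4 — the TWIST-CHARACTER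
# DICTIONARY, part 3 (the quadratic character): QUADRATIC KRONECKER–WEBER for an ODD fundamental
# discriminant `D = n*`, EXPLICIT — `σ(√n*) = (χ_n(σ)/n)·√n*` with the Jacobi character `(·/n)` as a
# quadratic `ℤ`-valued character modulo `n` whose reduction modulo `p` is PRIMITIVE

Width seat bsd-line-x2-p1-w3 (gen 8), cell `bsd-eis` (run/shared/lean/pub/bsd-eis/), 2026-08-28 — brick (F2) of LEAD
g10's WORKER FIT (STATUS l.3325). HONEST FRAMING: elementary algebra of Gauss sums and Dirichlet characters; THEOREMS
ONLY (no `def`, no named fact, no `sorry`); `--supports` stmt-BirchSwinnertonDyer-19033; closes no stub by itself; no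
summit statement, no Mazur main conjecture and no BSD is proved for any curve; 0 cells / labels / tiers move.

WHY. Parts 1–2 (`…TwistbackTwistLineCharacters{,Package}`, p648132/p648554) compute the line characters of the twist
`E^{(D)}` as the EXPLICIT primitive characters `φ·χ̄`, `ψ·χ̄` GIVEN a quadratic `ℤ`-valued character `χ` modulo `N`
with the radical relation `τ • √D = χ(χ_N(τ)) • √D` and `χ̄ = χ mod p` primitive. This file SUPPLIES that input for
every ODD fundamental discriminant — on the twistback road `D = d_K` for the admissible imaginary quadratic `K` with
`d_K` odd (the door `…TwistbackKLFlatPartner.upperPartner_at_of_klFlat_partner` has `Odd (discr K)`): an odd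
fundamental discriminant is `n* = (−1)^{(n−1)/2}·n` for `n = |D|` odd squarefree (`eq_negOnePow_mul_natAbs_of_emod_four`),
and `√n* = ± ∏_{q ∣ n} g_q` for the quadratic Gauss sums `g_q` (`g_q² = q*`, `τ g_q = (χ_q(τ)/q) g_q` — the tree's
`Rat.exists_gaussSum`, Ireland–Rosen Prop. 6.3.2), so `τ(√n*) = (χ_n(τ)/n)·√n*` with the Jacobi symbol.

* §1 `negOnePow_half_mul` — `(−1)^{⌊a/2⌋}(−1)^{⌊b/2⌋} = (−1)^{⌊ab/2⌋}` for odd `a`, `b` (`a* b* = (ab)*`);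
  `eq_negOnePow_mul_natAbs_of_emod_four` — `D ≡ 1 (mod 4)` ⟹ `D = (−1)^{⌊|D|/2⌋}·|D|`.
* §2 the three induction steps, each producing `(χ, s)` with `χ` quadratic, `χ̄` PRIMITIVE (mod `p`, `p` odd),
  `χ(a) = (a/n)` for every `a : ℕ`, `s ≠ 0`, `s² = n*`, `τ • s = χ(χ_n(τ))·s`: `exists_radical_one` (`n = 1`),
  `exists_radical_prime` (`n = q` an odd prime: `χ = (·/q)` = Mathlib's `quadraticChar (ZMod q)`, primitive by the
  tree's `X3Branch.legendreCharacter_isPrimitive`, `s` the Gauss sum), `exists_radical_mul` (coprime odd `a`, `b`: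
  characters multiply at level `ab` — PRIMITIVE by part 1's `isPrimitive_changeLevel_mul_changeLevel` — radicals
  multiply by the tree's `Rat.smul_mul_eq_changeLevel_mul`, values by `jacobiSym.mul_right`).
* §3 `exists_quadraticChar_radical` — for `n` odd squarefree (strong induction on `n`); `exists_quadraticChar_geomSqrt`
  — the same on the tree's chosen root `geomSqrt (n* : ℚ)` (`= ±s`); `exists_quadraticChar_geomSqrt_of_emod_four` —
  for `D ≡ 1 (mod 4)` with `|D|` squarefree, on `geomSqrt D`, character modulo `|D|` with `χ(a) = (a/|D|)`
  (`= (D/a)` for odd `a` by reciprocity, Cox (1.17) — tree `Quadratic.jacobiSym_natCast_natAbs_eq`, not used here).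

WHAT THIS GIVES THE LEAD: with parts 1–2, for an admissible `K` with `d_K` odd the KL-flat door's carrier characters
ARE `(φ_E·χ̄_{d_K}, ψ_E·χ̄_{d_K})` modulo `m|d_K|`, `d|d_K|`, primitive, with `χ_{d_K}(ℓ) = (ℓ/|d_K|)` — no
hypothesis on `χ` left. NOT here: even `d_K` (needs `χ₄`, `χ₈`: tree `Rat.exists_sqrt_neg_one_smul_eq_chi4`,
`X3BranchLineCharacterSqrtTwo`), the local `δ`-terms of the twist, the existence of admissible `K`.

References: [IrelandRosen1990] Ch. 6 Prop. 6.3.2 (quadratic Gauss sums), Ch. 5 §2 (Jacobi symbol);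
[Washington1997] Ch. 3 (Dirichlet characters as Galois characters; conductors); [Cox2013] §1.C Lemma 1.14, (1.17).
-/

set_option autoImplicit false

-- `Summit.BirchSwinnertonDyer.BirchSwinnertonDyer.…`: the summit and its single sub-problem share a name.
set_option linter.dupNamespace false

noncomputable section

open scoped Classical NumberTheorySymbols

open Field WeierstrassCurve
  Literature.NumberTheory.GaloisRepresentations Literature.NumberTheory.EllipticCurves
  Summit.BirchSwinnertonDyer.Rank1Residual.Additive
  Summit.BirchSwinnertonDyer.BirchSwinnertonDyer.Theorems.EisensteinPrimesMazurMCOnCellBTwistbackTwistLineCharacters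

namespace Summit.BirchSwinnertonDyer.BirchSwinnertonDyer.Theorems.EisensteinPrimesMazurMCOnCellBTwistbackQuadraticRadical

variable {p : ℕ} [hp : Fact p.Prime]

/-! ## §1. Arithmetic of `n* = (−1)^{⌊n/2⌋}·n` -/

omit hp in
/-- **`a*·b* = (ab)*` on the signs**: `(−1)^{⌊a/2⌋}·(−1)^{⌊b/2⌋} = (−1)^{⌊ab/2⌋}` for odd `a`, `b`
(`(a−1)/2 + (b−1)/2 ≡ (ab−1)/2 (mod 2)`). [cite: IrelandRosen1990, Ch. 5 §2 (proof of the reciprocity law for the Jacobi symbol)] -/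
theorem negOnePow_half_mul {a b : ℕ} (ha : Odd a) (hb : Odd b) :
    ((-1 : ℤ) ^ (a / 2)) * (-1) ^ (b / 2) = (-1) ^ (a * b / 2) := by
  obtain ⟨i, rfl⟩ := ha
  obtain ⟨j, rfl⟩ := hb
  have h1 : (2 * i + 1) / 2 = i := by omega
  have h2 : (2 * j + 1) / 2 = j := by omega
  have h3 : (2 * i + 1) * (2 * j + 1) / 2 = 2 * (i * j) + (i + j) := by
    have h : (2 * i + 1) * (2 * j + 1) = 2 * (2 * (i * j) + (i + j)) + 1 := by ring
    rw [h]
    omega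
  rw [h1, h2, h3, pow_add, pow_mul, neg_one_sq, one_pow, one_mul, pow_add]

omit hp in
/-- **An integer `D ≡ 1 (mod 4)` is `n*` for `n = |D|`**: `D = (−1)^{⌊|D|/2⌋}·|D|` (`|D| ≡ 1 (mod 4)` if `D > 0`,
`|D| ≡ 3 (mod 4)` if `D < 0`). [folklore] -/
theorem eq_negOnePow_mul_natAbs_of_emod_four {D : ℤ} (hD : D % 4 = 1) :
    D = (-1) ^ (D.natAbs / 2) * (D.natAbs : ℤ) := by
  rcases le_or_gt 0 D with h | h
  · have hn : (D.natAbs : ℤ) = D := Int.natAbs_of_nonneg h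
    have he : Even (D.natAbs / 2) := by
      have : (D.natAbs : ℤ) % 4 = 1 := by rw [hn]; exact hD
      rw [Nat.even_iff]; omega
    rw [he.neg_one_pow, one_mul, hn]
  · have hn : (D.natAbs : ℤ) = -D := Int.ofNat_natAbs_of_nonpos h.le
    have ho : Odd (D.natAbs / 2) := by
      have : (D.natAbs : ℤ) % 4 = 3 := by rw [hn]; omega
      rw [Nat.odd_iff]; omega
    rw [ho.neg_one_pow, hn, neg_one_mul, neg_neg]

/-! ## §2. The three induction steps: `n = 1`, `n = q` an odd prime (Gauss sum), coprime products -/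

omit hp in
/-- **Step `n = 1`**: the trivial character modulo `1` and the radical `s = 1` (`1* = 1`). [folklore] -/
theorem exists_radical_one :
    ∃ (χ : MulChar (ZMod 1) ℤ) (s : AlgebraicClosure ℚ), χ.IsQuadratic ∧
      DirichletCharacter.IsPrimitive (χ.ringHomComp (Int.castRingHom (ZMod p)) : DirichletCharacter (ZMod p) 1) ∧
      (∀ a : ℕ, χ (a : ZMod 1) = J((a : ℤ) | 1)) ∧ s ≠ 0 ∧
      s ^ 2 = (((-1 : ℤ) ^ (1 / 2) * (1 : ℕ) : ℤ) : AlgebraicClosure ℚ) ∧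
      ∀ τ : absoluteGaloisGroup ℚ,
        τ • s = ((χ (modNCyclotomicCharacter ℚ 1 τ : ZMod 1) : ℤ) : AlgebraicClosure ℚ) * s := by
  refine ⟨1, 1, fun a ↦ ?_, ?_, fun a ↦ ?_, one_ne_zero, by simp, fun τ ↦ ?_⟩
  · exact Or.inr (Or.inl (by rw [MulChar.one_apply (isUnit_of_subsingleton a)]))
  · rw [MulChar.ringHomComp_one]
    exact DirichletCharacter.isPrimitive_one_level_one
  · rw [MulChar.one_apply (isUnit_of_subsingleton _), jacobiSym.one_right]
  · rw [smul_one, MulChar.one_apply_coe, Int.cast_one, one_mul]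

/-- **Step `n = q`, an odd prime** (`p` odd too): `χ = (·/q)` (`quadraticChar (ZMod q)`, values the Legendre = Jacobi
symbol), quadratic, with PRIMITIVE reduction modulo `p` (tree `X3Branch.legendreCharacter_isPrimitive`), and the
quadratic Gauss sum `s = Σ (a/q) ζ_q^a`: `s ≠ 0`, `s² = (−1/q)·q = q*`, `τ s = (χ_q(τ)/q)·s` (tree `Rat.exists_gaussSum`).
[cite: IrelandRosen1990, Ch. 6 Prop. 6.3.2] [cite: Washington1997, Ch. 3 (conductors)] -/
theorem exists_radical_prime (hp2 : p ≠ 2) {q : ℕ} (hq : q.Prime) (hq2 : q ≠ 2) :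
    haveI : NeZero q := ⟨hq.ne_zero⟩
    ∃ (χ : MulChar (ZMod q) ℤ) (s : AlgebraicClosure ℚ), χ.IsQuadratic ∧
      DirichletCharacter.IsPrimitive (χ.ringHomComp (Int.castRingHom (ZMod p)) : DirichletCharacter (ZMod p) q) ∧
      (∀ a : ℕ, χ (a : ZMod q) = J((a : ℤ) | q)) ∧ s ≠ 0 ∧
      s ^ 2 = (((-1 : ℤ) ^ (q / 2) * q : ℤ) : AlgebraicClosure ℚ) ∧
      ∀ τ : absoluteGaloisGroup ℚ,
        τ • s = ((χ (modNCyclotomicCharacter ℚ q τ : ZMod q) : ℤ) : AlgebraicClosure ℚ) * s := by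
  haveI : Fact q.Prime := ⟨hq⟩
  haveI : NeZero (q : ℚ) := ⟨Nat.cast_ne_zero.mpr hq.ne_zero⟩
  obtain ⟨s, hs0, hs2, hsτ⟩ := Rat.exists_gaussSum (p := q) hq2
  have hqchar : ringChar (ZMod q) ≠ 2 := by rwa [ZMod.ringChar_zmod_n]
  have hneg1 : quadraticChar (ZMod q) (-1) = (-1) ^ (q / 2) := by
    rw [quadraticChar_neg_one hqchar, ZMod.card q]
    exact ZMod.χ₄_eq_neg_one_pow (Nat.odd_iff.mp (hq.odd_of_ne_two hq2))
  refine ⟨quadraticChar (ZMod q), s, quadraticChar_isQuadratic (ZMod q),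
    X3Branch.legendreCharacter_isPrimitive hp2 hq2, fun a ↦ ?_, hs0, ?_, hsτ⟩
  · rw [← jacobiSym.legendreSym.to_jacobiSym, legendreSym, Int.cast_natCast]
  · rw [hs2, hneg1]
    push_cast
    ring

omit hp in
/-- **Step `n = a·b`, `a`, `b` odd and coprime**: characters multiply at level `ab` (quadratic by
`MulChar.IsQuadratic.mul_int`; PRIMITIVE reduction by part 1's `isPrimitive_changeLevel_mul_changeLevel`; values
`(·/a)(·/b) = (·/ab)` by `jacobiSym.mul_right` and part 1's `changeLevel_mul_changeLevel_apply_natCast`), radicals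
multiply (`(s_a s_b)² = a* b* = (ab)*`; `τ(s_a s_b) = (χ_aχ_b)(χ_{ab} τ)·s_a s_b` by the tree's
`Rat.smul_mul_eq_changeLevel_mul`). [cite: IrelandRosen1990, Ch. 5 §2 and Ch. 6 Prop. 6.3.2] [cite: Washington1997, Ch. 3] -/
theorem exists_radical_mul {a b : ℕ} [NeZero a] [NeZero b] (ha : Odd a) (hb : Odd b)
    (hab : a.Coprime b) {χa : MulChar (ZMod a) ℤ} {χb : MulChar (ZMod b) ℤ} {sa sb : AlgebraicClosure ℚ}
    (hqa : χa.IsQuadratic) (hqb : χb.IsQuadratic)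
    (hpa : DirichletCharacter.IsPrimitive
      (χa.ringHomComp (Int.castRingHom (ZMod p)) : DirichletCharacter (ZMod p) a))
    (hpb : DirichletCharacter.IsPrimitive
      (χb.ringHomComp (Int.castRingHom (ZMod p)) : DirichletCharacter (ZMod p) b))
    (hva : ∀ n : ℕ, χa (n : ZMod a) = J((n : ℤ) | a)) (hvb : ∀ n : ℕ, χb (n : ZMod b) = J((n : ℤ) | b))
    (hsa0 : sa ≠ 0) (hsb0 : sb ≠ 0)
    (hsa2 : sa ^ 2 = (((-1 : ℤ) ^ (a / 2) * a : ℤ) : AlgebraicClosure ℚ))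
    (hsb2 : sb ^ 2 = (((-1 : ℤ) ^ (b / 2) * b : ℤ) : AlgebraicClosure ℚ))
    (hτa : ∀ τ : absoluteGaloisGroup ℚ,
      τ • sa = ((χa (modNCyclotomicCharacter ℚ a τ : ZMod a) : ℤ) : AlgebraicClosure ℚ) * sa)
    (hτb : ∀ τ : absoluteGaloisGroup ℚ,
      τ • sb = ((χb (modNCyclotomicCharacter ℚ b τ : ZMod b) : ℤ) : AlgebraicClosure ℚ) * sb) :
    ∃ (χ : MulChar (ZMod (a * b)) ℤ) (s : AlgebraicClosure ℚ), χ.IsQuadratic ∧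
      DirichletCharacter.IsPrimitive
        (χ.ringHomComp (Int.castRingHom (ZMod p)) : DirichletCharacter (ZMod p) (a * b)) ∧
      (∀ n : ℕ, χ (n : ZMod (a * b)) = J((n : ℤ) | a * b)) ∧ s ≠ 0 ∧
      s ^ 2 = (((-1 : ℤ) ^ (a * b / 2) * (a * b : ℕ) : ℤ) : AlgebraicClosure ℚ) ∧
      ∀ τ : absoluteGaloisGroup ℚ,
        τ • s = ((χ (modNCyclotomicCharacter ℚ (a * b) τ : ZMod (a * b)) : ℤ) : AlgebraicClosure ℚ) * s := by
  refine ⟨DirichletCharacter.changeLevel (dvd_mul_right a b) χa *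
      DirichletCharacter.changeLevel (dvd_mul_left b a) χb, sa * sb,
    (hqa.changeLevel_int _).mul_int (hqb.changeLevel_int _), ?_, fun n ↦ ?_, mul_ne_zero hsa0 hsb0, ?_,
    fun τ ↦ Rat.smul_mul_eq_changeLevel_mul (dvd_mul_right a b) (dvd_mul_left b a) χa χb hτa hτb τ⟩
  · rw [MulChar.ringHomComp_mul, DirichletCharacter.ringHomComp_changeLevel,
      DirichletCharacter.ringHomComp_changeLevel]
    exact isPrimitive_changeLevel_mul_changeLevel hpa hpb hab
  · rw [changeLevel_mul_changeLevel_apply_natCast, hva, hvb, jacobiSym.mul_right]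
  · rw [mul_pow, hsa2, hsb2, ← negOnePow_half_mul ha hb]
    push_cast
    ring

/-! ## §3. Quadratic Kronecker–Weber for `√n*`, `n` odd squarefree (explicit, with the Jacobi character) -/

/-- **QUADRATIC KRONECKER–WEBER, explicit, odd discriminant.** For `n` odd squarefree and `p` odd there are a
quadratic `ℤ`-valued character `χ` modulo `n` — the Jacobi character, `χ(a) = (a/n)` for every `a : ℕ` — whose
reduction `χ mod p` is a PRIMITIVE Dirichlet character modulo `n`, and a radical `s ≠ 0`, `s² = n* = (−1)^{⌊n/2⌋}·n`
(`s = ∏_{q ∣ n}` Gauss sums), with `τ • s = χ(χ_n(τ))·s` for every `τ ∈ Γ_ℚ`. Strong induction on `n` through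
`exists_radical_one` / `exists_radical_prime` / `exists_radical_mul`.
[cite: IrelandRosen1990, Ch. 6 Prop. 6.3.2 and Ch. 5 §2] [cite: Washington1997, Ch. 3 (the character of a quadratic field)] -/
theorem exists_quadraticChar_radical (hp2 : p ≠ 2) :
    ∀ (n : ℕ) [NeZero n], Odd n → Squarefree n →
      ∃ (χ : MulChar (ZMod n) ℤ) (s : AlgebraicClosure ℚ), χ.IsQuadratic ∧
        DirichletCharacter.IsPrimitive
          (χ.ringHomComp (Int.castRingHom (ZMod p)) : DirichletCharacter (ZMod p) n) ∧
        (∀ a : ℕ, χ (a : ZMod n) = J((a : ℤ) | n)) ∧ s ≠ 0 ∧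
        s ^ 2 = (((-1 : ℤ) ^ (n / 2) * n : ℤ) : AlgebraicClosure ℚ) ∧
        ∀ τ : absoluteGaloisGroup ℚ,
          τ • s = ((χ (modNCyclotomicCharacter ℚ n τ : ZMod n) : ℤ) : AlgebraicClosure ℚ) * s := by
  intro n
  induction n using Nat.strong_induction_on with
  | _ n ih =>
    intro _ hn hsq
    by_cases h1 : n = 1
    · subst h1
      exact exists_radical_one
    obtain ⟨q, hq, hqn⟩ : ∃ q, q.Prime ∧ q ∣ n := ⟨n.minFac, Nat.minFac_prime h1, Nat.minFac_dvd n⟩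
    obtain ⟨m, rfl⟩ := hqn
    have hm0 : m ≠ 0 := fun h ↦ NeZero.ne (q * m) (by rw [h, mul_zero])
    haveI : NeZero m := ⟨hm0⟩
    haveI : NeZero q := ⟨hq.ne_zero⟩
    have hqodd : Odd q := (Nat.odd_mul.mp hn).1
    have hmodd : Odd m := (Nat.odd_mul.mp hn).2
    have hq2 : q ≠ 2 := by
      rintro rfl
      exact (Nat.not_even_iff_odd.mpr hqodd) even_two
    have hcop : q.Coprime m := Nat.coprime_of_squarefree_mul hsq
    have hmsq : Squarefree m := hsq.of_mul_right
    have hlt : m < q * m := lt_mul_of_one_lt_left (Nat.pos_of_ne_zero hm0) hq.one_lt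
    obtain ⟨χm, sm, hqm, hpm, hvm, hsm0, hsm2, hτm⟩ := ih m hlt hmodd hmsq
    obtain ⟨χq, sq, hqq, hpq, hvq, hsq0, hsq2, hτq⟩ := exists_radical_prime (p := p) hp2 hq hq2
    exact exists_radical_mul hqodd hmodd hcop hqq hqm hpq hpm hvq hvm hsq0 hsm0 hsq2 hsm2 hτq hτm

/-- **The same on the tree's chosen square root `√n* = geomSqrt (n* : ℚ)`** (`= ±s`): for `n` odd squarefree and
`p` odd, a quadratic `χ` mod `n` with PRIMITIVE reduction mod `p`, `χ(a) = (a/n)`, and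
`τ • geomSqrt n* = χ(χ_n(τ)) • geomSqrt n*` for all `τ ∈ Γ_ℚ` — EXACTLY the radical relation consumed by parts 1–2
(`smul_eq_twistChar_of_mem_map_symm`, `exists_twistLine_ramifiedEven_characters`, …) with `N = n`, `D = n*`.
[cite: IrelandRosen1990, Ch. 6 Prop. 6.3.2] [cite: Washington1997, Ch. 3] -/
theorem exists_quadraticChar_geomSqrt (hp2 : p ≠ 2) {n : ℕ} [NeZero n] (hn : Odd n) (hsq : Squarefree n) :
    ∃ χ : MulChar (ZMod n) ℤ, χ.IsQuadratic ∧
      DirichletCharacter.IsPrimitive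
        (χ.ringHomComp (Int.castRingHom (ZMod p)) : DirichletCharacter (ZMod p) n) ∧
      (∀ a : ℕ, χ (a : ZMod n) = J((a : ℤ) | n)) ∧
      ∀ τ : absoluteGaloisGroup ℚ,
        τ • geomSqrt ((((-1 : ℤ) ^ (n / 2) * n : ℤ)) : ℚ) =
          ((χ (modNCyclotomicCharacter ℚ n τ : ZMod n) : ℤ) : AlgebraicClosure ℚ) *
            geomSqrt ((((-1 : ℤ) ^ (n / 2) * n : ℤ)) : ℚ) := by
  obtain ⟨χ, s, hq, hprim, hv, -, hs2, hτ⟩ := exists_quadraticChar_radical (p := p) hp2 n hn hsq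
  refine ⟨χ, hq, hprim, hv, fun τ ↦ ?_⟩
  -- `geomSqrt n* = ± s`
  have hs : geomSqrt ((((-1 : ℤ) ^ (n / 2) * n : ℤ)) : ℚ) = s ∨
      geomSqrt ((((-1 : ℤ) ^ (n / 2) * n : ℤ)) : ℚ) = -s := by
    apply sq_eq_sq_iff_eq_or_eq_neg.mp
    rw [geomSqrt_sq, hs2, map_intCast]
  rcases hs with h | h
  · rw [h, hτ τ]
  · rw [h, smul_neg, hτ τ, mul_neg]

/-- **QUADRATIC KRONECKER–WEBER for an odd fundamental discriminant `D`** (`D ≡ 1 (mod 4)`, `|D|` squarefree; on the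
twistback road `D = d_K` odd): for `p` odd there is a quadratic `ℤ`-valued character `χ` modulo `|D|` — the Jacobi
character `χ(a) = (a/|D|)` (`= (D/a)` at odd `a`, Cox (1.17)) — with PRIMITIVE reduction modulo `p`, such that
`τ • √D = χ(χ_{|D|}(τ)) • √D` for every `τ ∈ Γ_ℚ` (`√D = geomSqrt D`). With parts 1–2 the carrier characters of the
KL-flat door at the partner `E^{(d_K)}` are `(φ_E·χ̄, ψ_E·χ̄)` modulo `m|d_K|`, `d|d_K|`, PRIMITIVE.
[cite: IrelandRosen1990, Ch. 6 Prop. 6.3.2] [cite: Cox2013, §1.C Lemma 1.14 and (1.17)] [cite: Washington1997, Ch. 3] -/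
theorem exists_quadraticChar_geomSqrt_of_emod_four (hp2 : p ≠ 2) {D : ℤ} (hD : D % 4 = 1)
    (hsq : Squarefree D.natAbs) [NeZero D.natAbs] :
    ∃ χ : MulChar (ZMod D.natAbs) ℤ, χ.IsQuadratic ∧
      DirichletCharacter.IsPrimitive
        (χ.ringHomComp (Int.castRingHom (ZMod p)) : DirichletCharacter (ZMod p) D.natAbs) ∧
      (∀ a : ℕ, χ (a : ZMod D.natAbs) = J((a : ℤ) | D.natAbs)) ∧
      ∀ τ : absoluteGaloisGroup ℚ,
        τ • geomSqrt ((D : ℤ) : ℚ) =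
          ((χ (modNCyclotomicCharacter ℚ D.natAbs τ : ZMod D.natAbs) : ℤ) : AlgebraicClosure ℚ) *
            geomSqrt ((D : ℤ) : ℚ) := by
  have hodd : Odd D.natAbs := by
    rw [Int.natAbs_odd, Int.odd_iff]
    omega
  have hD' := eq_negOnePow_mul_natAbs_of_emod_four hD
  obtain ⟨χ, hq, hprim, hv, hτ⟩ := exists_quadraticChar_geomSqrt (p := p) hp2 hodd hsq
  refine ⟨χ, hq, hprim, hv, fun τ ↦ ?_⟩
  have h := hτ τ
  rw [← hD'] at h
  exact h

end Summit.BirchSwinnertonDyer.BirchSwinnertonDyer.Theorems.EisensteinPrimesMazurMCOnCellBTwistbackQuadraticRadical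

end
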